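import Summits.BirchSwinnertonDyer.BirchSwinnertonDyer.Theorems.ByReductionTypeAtTwoSupersingularIwasawaTranslation
import Summits.BirchSwinnertonDyer.BirchSwinnertonDyer.Theorems.ByReductionTypeAtTwoSupersingularIwasawaTwistDualPairLemmas
import HarnessLib

/-!
# Route `ByReductionTypeAtTwo` (rung K4), crux `SupersingularRankZeroAtTwo` (item stmt-BirchSwinnertonDyer-19097):
# the dual pair TWISTED by a translation `T ↦ T + n` (`p ∣ n`) — brick [C'] of K67-EC (packaging)
# (seat `bsd-2adic-ss-1`, GEN 17; companion of `…IwasawaTranslation` / `…IwasawaTwistDualPairLemmas`)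

HONEST FRAMING (cell `bsd-2adic`, run/shared/lean/pub/bsd-2adic/): generic `Λ = ℤ_p⟦T⟧`-algebra only.
ONE type synonym `Twisted ht X := X` (the `Λ`-module `X` with scalars restricted along the translation
automorphism `τ_t`, `IwasawaTranslation.translate ht`) with its two structure instances (on the NEW type
only; no instance on any existing type), and THEOREMS: the twisted module is finitely generated /
torsion when `X` is, and an axiomatic Pontryagin dual pair `(X, S, ψ)` (`IwasawaDual.IsDualPair p ψ`)
twists to the dual pair `(X^{τ_n}, S, ψ + n)` for `p ∣ n` — at `p = 2`, `n = 2`: `T + 2 ↔ γ + 1`, the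
ORDER-2 character. No named fact, no `sorry`; nothing about any curve; nothing booked; BSD is not
proved by any of this. PARTITION (D-0054): X5@2 good-ss r₀ block × p = 2 — types-the-object-of; closes
none. bears_on: K4 (route-BirchSwinnertonDyer-ByReductionTypeAtTwo item 19097).

## What and why

K67-EC (`OddBlindPackage.FlatBlindEulerCharAtTwo`, stub 4 of `Cruxes/…/Lines/odd_blind_package.lean`) =
Greenberg's Lemma 4.2 (tree: `IwasawaDual.IsDualPair.constantCoeff_charGenerator_mul_natCard_endCoinvariants`,
ANY dual pair) for the pair produced HERE from a ♭ dual Selmer datum: `isDualPair_twisted`.  What then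
remains for K67-EC is [B] alone: the characteristic ideal of `Twisted ht X` is `τ_{-t}` of that of `X`
(so that its generator is read at `0` as `f(-2)` by `IwasawaTranslation.constantCoeff_translate`), plus
the one-screen application [D].

* `Twisted ht X`, `toTwisted : X ≃+ Twisted ht X`, `smul_toTwisted` (`r • x̃ = (τ_t r • x)~`),
  `X_smul_toTwisted` (`T • x̃ = ((T + t) • x)~`), `C_smul_toTwisted`;
* `moduleFinite_twisted`, `isTorsion_twisted`;
* **`isDualPair_twisted`**: `IsDualPair p ψ toDual → IsDualPair p (ψ + n) (toDual ∘ toTwisted⁻¹)`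
  for the twist by `t = n`, `p ∣ n` (fields: `bijective` verbatim; `T_smul` =
  `toDual_X_add_C_natCast_smul`; `C_smul` verbatim via `translate_C`; `locNil` =
  `isLocNil_add_natCast_of_dvd` — the place where `p ∣ n`, i.e. `p = 2` for the order-2 character, enters).

References: R. Greenberg, LNM 1716 (1999), §1 p. 60, §4 Lemma 4.2 [cite: GreenbergLNM1716, §4 Lemma 4.2];
B. Mazur, J. Tate, J. Teitelbaum, Invent. Math. 84 (1986), §I.14 [cite: MazurTateTeitelbaum1986Invent, §I.14].
-/

set_option autoImplicit false
-- the Theorems namespace of this sub repeats the summit name by design (D-0017 nested layout)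
set_option linter.dupNamespace false

noncomputable section

namespace Summit.BirchSwinnertonDyer.BirchSwinnertonDyer.Theorems

namespace IwasawaTranslation

open Literature.NumberTheory.EllipticCurves Literature.NumberTheory.EllipticCurves.IwasawaDual

universe u

variable {p : ℕ} [Fact p.Prime]

/-! ### The twisted module -/

/-- **`X` with scalars restricted along the translation `τ_t`** (`‖t‖ < 1`): the same additive group,
`r ∈ Λ` acting as `τ_t(r)`; so `T` acts as `T + t`.  A type synonym. [folklore] -/
@[nolint unusedArguments]
def Twisted {t : ℤ_[p]} (_ht : ‖t‖ < 1) (X : Type u) : Type u := X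

namespace Twisted

variable {t : ℤ_[p]} (ht : ‖t‖ < 1) (X : Type u) [AddCommGroup X] [Module (PowerSeries ℤ_[p]) X]

/-- The additive group of the twisted module is that of `X`. -/
instance instAddCommGroup : AddCommGroup (Twisted ht X) := inferInstanceAs (AddCommGroup X)

/-- The twisted scalar action: `r • x := τ_t(r) • x`. -/
instance instModule : Module (PowerSeries ℤ_[p]) (Twisted ht X) :=
  Module.compHom X ((translate ht : PowerSeries ℤ_[p] →ₐ[ℤ_[p]] PowerSeries ℤ_[p]) :
    PowerSeries ℤ_[p] →+* PowerSeries ℤ_[p])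

end Twisted

section TwistedAPI

variable {t : ℤ_[p]} (ht : ‖t‖ < 1) {X : Type u} [AddCommGroup X] [Module (PowerSeries ℤ_[p]) X]

/-- The identity `X ≃+ Twisted ht X` (additive; NOT `Λ`-linear). [folklore] -/
def toTwisted : X ≃+ Twisted ht X := AddEquiv.refl X

/-- **The twisted action through `toTwisted`: `r • x̃ = (τ_t(r) • x)~`.** [folklore] -/
theorem smul_toTwisted (r : PowerSeries ℤ_[p]) (x : X) :
    r • toTwisted ht x = toTwisted ht (translate ht r • x) :=
  rfl

/-- `T` acts on the twisted module as `T + t`: `T • x̃ = ((T + C t) • x)~`. [folklore] -/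
theorem X_smul_toTwisted (x : X) :
    (PowerSeries.X : PowerSeries ℤ_[p]) • toTwisted ht x =
      toTwisted ht ((PowerSeries.X + PowerSeries.C t) • x) := by
  rw [smul_toTwisted, translate_X]

/-- Constants act on the twisted module as before: `C c • x̃ = (C c • x)~`. [folklore] -/
theorem C_smul_toTwisted (c : ℤ_[p]) (x : X) :
    (PowerSeries.C c : PowerSeries ℤ_[p]) • toTwisted ht x = toTwisted ht (PowerSeries.C c • x) := by
  rw [smul_toTwisted, translate_C]

omit [Module (PowerSeries ℤ_[p]) X] in
/-- `toTwisted` is surjective (it is a bijection). [folklore] -/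
theorem toTwisted_surjective : Function.Surjective (toTwisted ht (X := X)) :=
  (toTwisted ht).surjective

/-- **The twisted module is finitely generated when `X` is** (same generators: `a • x = (τ_{-t} a) •~ x`).
[folklore] -/
theorem moduleFinite_twisted [Module.Finite (PowerSeries ℤ_[p]) X] :
    Module.Finite (PowerSeries ℤ_[p]) (Twisted ht X) := by
  classical
  obtain ⟨s, hs⟩ := Module.Finite.fg_top (R := PowerSeries ℤ_[p]) (M := X)
  refine ⟨⟨s.image (toTwisted ht), ?_⟩⟩
  rw [eq_top_iff]
  rintro y -
  obtain ⟨x, rfl⟩ := toTwisted_surjective ht y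
  have hx : x ∈ Submodule.span (PowerSeries ℤ_[p]) (s : Set X) := by rw [hs]; exact Submodule.mem_top
  induction hx using Submodule.span_induction with
  | mem z hz =>
    exact Submodule.subset_span (Finset.mem_coe.mpr (Finset.mem_image_of_mem _ (Finset.mem_coe.mp hz)))
  | zero => rw [map_zero]; exact Submodule.zero_mem _
  | add a b _ _ ha hb => rw [map_add]; exact Submodule.add_mem _ ha hb
  | smul r a _ ha =>
    have hr : r • a = translate ht (translate (norm_neg_lt_one ht) r) • a := by
      rw [translate_translate_neg ht]
    rw [hr, ← smul_toTwisted]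
    exact Submodule.smul_mem _ _ ha

/-- **The twisted module is `Λ`-torsion when `X` is** (`a • x = 0`, `a ≠ 0` ⇒ `(τ_{-t} a) •~ x̃ = 0`,
`τ_{-t} a ≠ 0`; `Λ` is a domain). [folklore] -/
theorem isTorsion_twisted (hX : Module.IsTorsion (PowerSeries ℤ_[p]) X) :
    Module.IsTorsion (PowerSeries ℤ_[p]) (Twisted ht X) := by
  intro y
  obtain ⟨x, rfl⟩ := toTwisted_surjective ht y
  obtain ⟨⟨a, ha⟩, hax⟩ := @hX x
  have ha0 : a ≠ 0 := nonZeroDivisors.ne_zero ha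
  refine ⟨⟨translate (norm_neg_lt_one ht) a, mem_nonZeroDivisors_of_ne_zero ?_⟩, ?_⟩
  · intro h0
    apply ha0
    have := congrArg (translate ht) h0
    rwa [translate_translate_neg ht, map_zero] at this
  · change translate (norm_neg_lt_one ht) a • toTwisted ht x = 0
    rw [smul_toTwisted, translate_translate_neg ht, show a • x = 0 from hax, map_zero]

end TwistedAPI

/-! ### The twisted dual pair -/

section DualPair

variable {S : Type*} [AddCommGroup S] {ψ : AddMonoid.End S}
variable {X : Type u} [AddCommGroup X] [Module (PowerSeries ℤ_[p]) X]
variable {toDual : X →+ (S →+ AddCircle (1 : ℚ))}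

/-- A natural number divisible by `p` lies in the open unit disc of `ℤ_p`. [folklore] -/
theorem norm_natCast_lt_one_of_dvd {n : ℕ} (hn : p ∣ n) : ‖((n : ℕ) : ℤ_[p])‖ < 1 := by
  rw [PadicInt.norm_lt_one_iff_dvd]
  obtain ⟨m, rfl⟩ := hn
  exact ⟨m, by push_cast; rfl⟩

/-- **The twisted dual pair.**  If `(X, S, ψ, toDual)` is a dual pair (`T ↔ ψ`) then so is
`(X^{τ_n}, S, ψ + n, toDual ∘ toTwisted⁻¹)` for every `n` with `p ∣ n`: `T` acts on `X^{τ_n}` as `T + n`,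
dual to `ψ + n`.  At `p = 2`, `n = 2`, `ψ = conj_γ - 1` this is the pair at the ORDER-2 character
(`γ + 1 = (γ - 1) + 2`), to which the tree's Lemma 4.2 for dual pairs applies verbatim. [folklore] -/
theorem isDualPair_twisted (h : IsDualPair p ψ toDual) {n : ℕ} (hn : p ∣ n) :
    IsDualPair p (ψ + (n : AddMonoid.End S))
      (toDual.comp (toTwisted (norm_natCast_lt_one_of_dvd hn) (X := X)).symm.toAddMonoidHom) where
  bijective := h.bijective.comp (toTwisted (norm_natCast_lt_one_of_dvd hn)).symm.bijective
  T_smul y s := by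
    obtain ⟨x, rfl⟩ := toTwisted_surjective (norm_natCast_lt_one_of_dvd hn) y
    rw [X_smul_toTwisted]
    exact toDual_X_add_C_natCast_smul h n x s
  C_smul c y s k hk := by
    obtain ⟨x, rfl⟩ := toTwisted_surjective (norm_natCast_lt_one_of_dvd hn) y
    rw [C_smul_toTwisted]
    exact h.C_smul c x s k hk
  locNil := isLocNil_add_natCast_of_dvd h.locNil hn

end DualPair

end IwasawaTranslation

end Summit.BirchSwinnertonDyer.BirchSwinnertonDyer.Theorems

end
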